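import Literature.Barriers.CriticalPhenomena.TimarLevelExhaustion
import HarnessLib

/-!
# Timár 2006, Prop. 5.4 on QUASI-TRANSITIVE graphs: an invariant exhaustion of the levels — PROVED

Barrier catalogue `Literature/Barriers/CriticalPhenomena/`; the quasi-transitive twin of the
graph-level part of `TimarLevelExhaustion.lean` (TRANSITIVE graphs). Á. Timár, *Percolation on
nonunimodular transitive graphs*, Ann. Probab. 34 (2006) 2344–2364, §5, Prop. 5.4 and the
paragraph before it (arXiv:math/0702875, pp. 16–17):

> "Let `R ⊃ {log w(ℓ) : ℓ is a level}` be the additive group generated by the elements of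
> `{log_μ (w(x)/w(y)) : x and y are adjacent}`, which is finite because `G` is locally finite
> [and transitive]. Since `R` is torsion-free, it is isomorphic to `ℤⁿ` for some `n`. Any
> automorphism of `G` acts on the weights of the levels by multiplying them with a constant, so it
> acts on `R` by adding some constant. … **Proposition 5.4.** There is an invariant random sequence
> of nested partitions `P_i` of the levels of `G` into finite sets which exhausts them."

On a quasi-transitive graph the group generated by the adjacent log-ratios need not contain the
heights `log w(x)` themselves (the base vertex `o` sees only its own orbit). We therefore take for
`R` the subgroup of `ℝ` generated by the heights of a finite complete set `S₀` of orbit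
representatives together with the finitely many adjacent differences at `S₀`
(`heightGroupQ G hqt o`): it is finitely generated, hence free of finite rank
(`moduleFree_of_addSubgroup_real_fg`, reused), it contains every height
(`levelHeight_mem_heightGroupQ`: `log w(x) = log w(s) - log w(γ o)` for `γ x = s ∈ S₀`, and
`log w(γ o)` is a sum of adjacent differences along a walk), and `Aut(G)` acts on it by the
translations `c_γ = log w(γ o) ∈ R` (`levelEltQ_map`). From there the tree's construction — the
box exhaustion of `ℤⁿ` transferred to `R` (`ExhaustionRel`, `exhaustionShift`, all reused) — gives
Prop. 5.4 verbatim: `LevelExhaustionRelQ`, `levelExhaustionActQ`, the classes are finite unions of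
levels (`exists_setOf_levelExhaustionRelQ_eq_levelUnion`), invariance
(`levelExhaustionRelQ_act_iff`), measurability, exhaustion (`tendsto_measure_levelExhaustionRelQ`,
`tendsto_measure_not_forall_levelExhaustionRelQ`), and the package
`Timar2006_prop54_levels_quasiTransitive`.

## References

* Á. Timár, Ann. Probab. 34 (2006) 2344–2364 (arXiv:math/0702875), §5, Prop. 5.4 and the
  paragraph before it; proof of Thm. 5.5 ("any set of finitely many levels … with probability
  tending to 1"). [Timar2006]
* T. Hutchcroft, C. R. Math. Acad. Sci. Paris 354 (2016) 944–947, §2 (quasi-transitive setting).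
  [Hutchcroft2016]
-/

noncomputable section

namespace Literature.Barriers.CriticalPhenomena

open _root_.MeasureTheory _root_.Filter _root_.Topology
open Literature.Probability.LatticeModels Literature.Probability.Percolation

open scoped _root_.ENNReal

section HeightGroup

variable {V : Type*}

/-- A finite complete set of orbit representatives of a quasi-transitive graph (a choice).
[cite: Hutchcroft2016, §2 (quasi-transitive: finitely many orbits)] -/
def qtReps {G : SimpleGraph V} (hqt : IsQuasiTransitive G) : Finset V := Classical.choose hqt

/-- Every vertex is moved into `qtReps` by some automorphism. [folklore] -/
theorem exists_map_mem_qtReps {G : SimpleGraph V} (hqt : IsQuasiTransitive G) (v : V) :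
    ∃ γ : G ≃g G, γ v ∈ qtReps hqt := Classical.choose_spec hqt v

/-- The finite generating set: the heights of the representatives and the adjacent height
differences at the representatives. [cite: Timar2006, §5 (the set R: "generated by … adjacent", "finite because G is locally finite")] -/
def heightGens (G : SimpleGraph V) [G.LocallyFinite] (hqt : IsQuasiTransitive G) (o : V) : Finset ℝ := by
  classical
  exact (qtReps hqt).image (levelHeight G o) ∪
    (qtReps hqt).biUnion fun s => (G.neighborFinset s).image fun n => levelHeight G o n - levelHeight G o s

/-- **The level group `R` of a quasi-transitive graph**: the subgroup of `ℝ` generated by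
`heightGens`. [cite: Timar2006, §5 (the set R)] -/
def heightGroupQ (G : SimpleGraph V) [G.LocallyFinite] (hqt : IsQuasiTransitive G) (o : V) :
    AddSubgroup ℝ :=
  AddSubgroup.closure ↑(heightGens G hqt o)

/-- `R` is finitely generated. [cite: Timar2006, §5 ("which is finite because G is locally finite")] -/
theorem heightGroupQ_fg (G : SimpleGraph V) [G.LocallyFinite] (hqt : IsQuasiTransitive G) (o : V) :
    (heightGroupQ G hqt o).FG :=
  ⟨heightGens G hqt o, rfl⟩

/-- `R` is a finite `ℤ`-module … [folklore] -/
instance heightGroupQ.moduleFinite (G : SimpleGraph V) [G.LocallyFinite] (hqt : IsQuasiTransitive G)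
    (o : V) : Module.Finite ℤ (heightGroupQ G hqt o) :=
  moduleFinite_of_addSubgroup_fg (heightGroupQ_fg G hqt o)

/-- … and a free one ("Since `R` is torsion-free, it is isomorphic to `ℤⁿ` for some `n`").
[cite: Timar2006, §5 (paragraph before Prop. 5.4)] -/
instance heightGroupQ.moduleFree (G : SimpleGraph V) [G.LocallyFinite] (hqt : IsQuasiTransitive G)
    (o : V) : Module.Free ℤ (heightGroupQ G hqt o) :=
  moduleFree_of_addSubgroup_real_fg (heightGroupQ_fg G hqt o)

/-- Adjacent height differences lie in `R` (move the edge to a representative; the difference is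
invariant, `levelHeight_map`). [cite: Timar2006, §5 (the set R)] -/
theorem levelHeight_sub_mem_heightGroupQ (G : SimpleGraph V) [G.LocallyFinite] (hconn : G.Connected)
    (hqt : IsQuasiTransitive G) (o : V) {a b : V} (hab : G.Adj a b) :
    levelHeight G o b - levelHeight G o a ∈ heightGroupQ G hqt o := by
  classical
  obtain ⟨γ, hγ⟩ := exists_map_mem_qtReps hqt a
  have hadj : G.Adj (γ a) (γ b) := (γ.map_rel_iff').2 hab
  have heq : levelHeight G o b - levelHeight G o a = levelHeight G o (γ b) - levelHeight G o (γ a) := by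
    rw [levelHeight_map G hconn γ o a, levelHeight_map G hconn γ o b]; ring
  rw [heq]
  refine AddSubgroup.subset_closure ?_
  rw [heightGens, Finset.coe_union]
  refine Or.inr ?_
  rw [Finset.mem_coe, Finset.mem_biUnion]
  exact ⟨γ a, hγ, Finset.mem_image.2 ⟨γ b, (G.mem_neighborFinset _ _).2 hadj, rfl⟩⟩

/-- Height differences along walks lie in `R`. [folklore] -/
theorem levelHeight_sub_mem_heightGroupQ_of_walk (G : SimpleGraph V) [G.LocallyFinite]
    (hconn : G.Connected) (hqt : IsQuasiTransitive G) (o : V) {a b : V} (q : G.Walk a b) :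
    levelHeight G o b - levelHeight G o a ∈ heightGroupQ G hqt o := by
  induction q with
  | nil => rw [sub_self]; exact zero_mem _
  | @cons a c b hac q ih =>
    have : levelHeight G o b - levelHeight G o a =
        (levelHeight G o b - levelHeight G o c) + (levelHeight G o c - levelHeight G o a) := by ring
    rw [this]
    exact add_mem ih (levelHeight_sub_mem_heightGroupQ G hconn hqt o hac)

/-- **Every height lies in `R`** (`R ⊇ {log w(ℓ)}`): `log w(x) = log w(s) - log w(γ o)` for
`γ x = s ∈ S₀`. [cite: Timar2006, §5 (the set R ⊃ {log w(ℓ)})] -/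
theorem levelHeight_mem_heightGroupQ (G : SimpleGraph V) [G.LocallyFinite] (hconn : G.Connected)
    (hqt : IsQuasiTransitive G) (o x : V) : levelHeight G o x ∈ heightGroupQ G hqt o := by
  classical
  obtain ⟨γ, hγ⟩ := exists_map_mem_qtReps hqt x
  have h1 : levelHeight G o x = levelHeight G o (γ x) - levelHeight G o (γ o) := by
    rw [levelHeight_map G hconn γ o x]; ring
  rw [h1]
  refine sub_mem (AddSubgroup.subset_closure ?_) ?_
  · rw [heightGens, Finset.coe_union]
    exact Or.inl (Finset.mem_coe.2 (Finset.mem_image.2 ⟨γ x, hγ, rfl⟩))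
  · obtain ⟨q⟩ := hconn.preconnected o (γ o)
    have := levelHeight_sub_mem_heightGroupQ_of_walk G hconn hqt o q
    rwa [levelHeight_self G hconn o, sub_zero] at this

/-- The height of `x` as an element of `R`. [cite: Timar2006, §5 (the set R)] -/
def levelEltQ (G : SimpleGraph V) [G.LocallyFinite] (hconn : G.Connected) (hqt : IsQuasiTransitive G)
    (o x : V) : heightGroupQ G hqt o :=
  ⟨levelHeight G o x, levelHeight_mem_heightGroupQ G hconn hqt o x⟩

/-- The element of `R` attached to `x` is its height. [folklore] -/
@[simp] theorem coe_levelEltQ (G : SimpleGraph V) [G.LocallyFinite] (hconn : G.Connected)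
    (hqt : IsQuasiTransitive G) (o x : V) : (levelEltQ G hconn hqt o x : ℝ) = levelHeight G o x := rfl

/-- The constant by which `γ` translates `R`: the height of `γ o`. [cite: Timar2006, §5 ("it acts on R by adding some constant")] -/
def autHeightQ (G : SimpleGraph V) [G.LocallyFinite] (hconn : G.Connected) (hqt : IsQuasiTransitive G)
    (o : V) (γ : G ≃g G) : heightGroupQ G hqt o :=
  levelEltQ G hconn hqt o (γ o)

/-- **`Aut(G)` acts on the levels, read in `R`, by translations**: `[γ v] = [v] + c_γ`.
[cite: Timar2006, §5 (paragraph before Prop. 5.4)] -/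
theorem levelEltQ_map (G : SimpleGraph V) [G.LocallyFinite] (hconn : G.Connected)
    (hqt : IsQuasiTransitive G) (o : V) (γ : G ≃g G) (v : V) :
    levelEltQ G hconn hqt o (γ v) = levelEltQ G hconn hqt o v + autHeightQ G hconn hqt o γ := by
  apply Subtype.ext
  simp only [coe_levelEltQ, autHeightQ, AddSubgroup.coe_add]
  exact levelHeight_map G hconn γ o v

/-- The translation constants form a cocycle: `c_{γ' ∘ γ} = c_γ + c_{γ'}`. [folklore] -/
theorem autHeightQ_trans (G : SimpleGraph V) [G.LocallyFinite] (hconn : G.Connected)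
    (hqt : IsQuasiTransitive G) (o : V) (γ γ' : G ≃g G) :
    autHeightQ G hconn hqt o (γ.trans γ') = autHeightQ G hconn hqt o γ + autHeightQ G hconn hqt o γ' := by
  apply Subtype.ext
  simp only [autHeightQ, coe_levelEltQ, AddSubgroup.coe_add]
  change levelHeight G o (γ' (γ o)) = _
  rw [levelHeight_map G hconn γ' o (γ o)]

/-- The identity translates `R` by `0`. [folklore] -/
@[simp] theorem autHeightQ_refl (G : SimpleGraph V) [G.LocallyFinite] (hconn : G.Connected)
    (hqt : IsQuasiTransitive G) (o : V) : autHeightQ G hconn hqt o (RelIso.refl _) = 0 := by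
  apply Subtype.ext
  simp only [autHeightQ, coe_levelEltQ, AddSubgroup.coe_zero]
  exact levelHeight_self G hconn o

/-- Same level iff same element of `R`. [cite: Timar2006, §2 and §5] -/
theorem sameLevel_iff_levelEltQ_eq (G : SimpleGraph V) [G.LocallyFinite] (hconn : G.Connected)
    (hqt : IsQuasiTransitive G) (o x y : V) :
    SameLevel G x y ↔ levelEltQ G hconn hqt o x = levelEltQ G hconn hqt o y := by
  rw [sameLevel_iff_levelHeight_eq G hconn o, Subtype.ext_iff, coe_levelEltQ, coe_levelEltQ]

/-! #### The exhaustion of the levels of `G` -/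

/-- **The random partitions of the LEVELS of `G`** (quasi-transitive): `x ∼_m y` iff the levels of
`x` and `y`, read in `R ≅ ℤⁿ`, are in the same class of the `m`-th box partition.
[cite: Timar2006, Prop. 5.4] -/
def LevelExhaustionRelQ (G : SimpleGraph V) [G.LocallyFinite] (hconn : G.Connected)
    (hqt : IsQuasiTransitive G) (o : V) (m : ℕ) (ξ : ExhaustionSeeds (heightGroupQ G hqt o)) (x y : V) : Prop :=
  ExhaustionRel m ξ (levelEltQ G hconn hqt o x) (levelEltQ G hconn hqt o y)

/-- The action of `Aut(G)` on the seeds of the level exhaustion (through `γ ↦ c_γ ∈ R`).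
[cite: Timar2006, Prop. 5.4 ("invariant")] -/
def levelExhaustionActQ (G : SimpleGraph V) [G.LocallyFinite] (hconn : G.Connected)
    (hqt : IsQuasiTransitive G) (o : V) (γ : G ≃g G) :
    ExhaustionSeeds (heightGroupQ G hqt o) → ExhaustionSeeds (heightGroupQ G hqt o) :=
  exhaustionShift (autHeightQ G hconn hqt o γ)

section

variable (G : SimpleGraph V) [G.LocallyFinite] (hconn : G.Connected) (hqt : IsQuasiTransitive G) (o : V)

/-- Each stage is a partition of the vertices … [cite: Timar2006, Prop. 5.4] -/
theorem levelExhaustionRelQ_equivalence (m : ℕ) (ξ : ExhaustionSeeds (heightGroupQ G hqt o)) :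
    Equivalence (LevelExhaustionRelQ G hconn hqt o m ξ) :=
  ⟨fun _ => exhaustionRel_refl _ _ _, fun h => ExhaustionRel.symm h,
    fun h₁ h₂ => ExhaustionRel.trans h₁ h₂⟩

/-- … saturated with respect to the levels. [cite: Timar2006, Prop. 5.4 ("partitions the set of levels")] -/
theorem levelExhaustionRelQ_of_sameLevel {m : ℕ} {ξ : ExhaustionSeeds (heightGroupQ G hqt o)} {x x' y : V}
    (hx : SameLevel G x x') (h : LevelExhaustionRelQ G hconn hqt o m ξ x y) :
    LevelExhaustionRelQ G hconn hqt o m ξ x' y := by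
  unfold LevelExhaustionRelQ at h ⊢
  rwa [← (sameLevel_iff_levelEltQ_eq G hconn hqt o x x').1 hx]

/-- Saturation with respect to the levels, in the second argument. [cite: Timar2006, Prop. 5.4 ("partitions the set of levels")] -/
theorem levelExhaustionRelQ_of_sameLevel_right {m : ℕ} {ξ : ExhaustionSeeds (heightGroupQ G hqt o)}
    {x y y' : V} (hy : SameLevel G y y') (h : LevelExhaustionRelQ G hconn hqt o m ξ x y) :
    LevelExhaustionRelQ G hconn hqt o m ξ x y' := by
  unfold LevelExhaustionRelQ at h ⊢
  rwa [← (sameLevel_iff_levelEltQ_eq G hconn hqt o y y').1 hy]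

/-- Vertices on a common level are always related. [folklore] -/
theorem levelExhaustionRelQ_of_sameLevel_self {m : ℕ} {ξ : ExhaustionSeeds (heightGroupQ G hqt o)} {x y : V}
    (h : SameLevel G x y) : LevelExhaustionRelQ G hconn hqt o m ξ x y :=
  levelExhaustionRelQ_of_sameLevel_right G hconn hqt o h ((levelExhaustionRelQ_equivalence G hconn hqt o m ξ).refl x)

/-- **The classes are finite unions of levels.** [cite: Timar2006, Prop. 5.4 ("partitions the set of levels of G into finite sets")] -/
theorem exists_setOf_levelExhaustionRelQ_eq_levelUnion (m : ℕ) (ξ : ExhaustionSeeds (heightGroupQ G hqt o))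
    (x : V) : ∃ S : Finset V, {y | LevelExhaustionRelQ G hconn hqt o m ξ x y} = levelUnion G S := by
  classical
  have hfin := finite_setOf_exhaustionRel m ξ (levelEltQ G hconn hqt o x)
  set T : Set (heightGroupQ G hqt o) := {b | ExhaustionRel m ξ (levelEltQ G hconn hqt o x) b ∧
    ∃ y : V, levelEltQ G hconn hqt o y = b} with hT
  have hTfin : T.Finite := hfin.subset fun b hb => hb.1
  have hchoice : ∀ b : T, ∃ y : V, levelEltQ G hconn hqt o y = b := fun b => b.2.2
  choose f hf using hchoice
  haveI : Fintype T := hTfin.fintype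
  refine ⟨Finset.univ.image f, ?_⟩
  ext y
  simp only [Set.mem_setOf_eq, mem_levelUnion_iff, Finset.mem_image, Finset.mem_univ, true_and]
  constructor
  · intro hy
    have hbT : levelEltQ G hconn hqt o y ∈ T := ⟨hy, y, rfl⟩
    refine ⟨f ⟨_, hbT⟩, ⟨⟨_, hbT⟩, rfl⟩, ?_⟩
    rw [sameLevel_iff_levelEltQ_eq G hconn hqt o, hf]
  · rintro ⟨s, ⟨b, rfl⟩, hs⟩
    have h1 : LevelExhaustionRelQ G hconn hqt o m ξ x (f b) := by
      unfold LevelExhaustionRelQ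
      rw [hf]
      exact b.2.1
    exact levelExhaustionRelQ_of_sameLevel_right G hconn hqt o hs h1

/-- **Invariance under `Aut(G)`**. [cite: Timar2006, Prop. 5.4 ("invariant random sequence")] -/
theorem levelExhaustionRelQ_act_iff (m : ℕ) (ξ : ExhaustionSeeds (heightGroupQ G hqt o)) (γ : G ≃g G)
    (x y : V) :
    LevelExhaustionRelQ G hconn hqt o m (levelExhaustionActQ G hconn hqt o γ ξ) (γ x) (γ y) ↔
      LevelExhaustionRelQ G hconn hqt o m ξ x y := by
  unfold LevelExhaustionRelQ levelExhaustionActQ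
  rw [levelEltQ_map, levelEltQ_map, exhaustionRel_exhaustionShift_iff']

/-- The action of `Aut(G)` on the seeds is compatible with composition. [folklore] -/
theorem levelExhaustionActQ_trans (γ γ' : G ≃g G) (ξ : ExhaustionSeeds (heightGroupQ G hqt o)) :
    levelExhaustionActQ G hconn hqt o (γ.trans γ') ξ =
      levelExhaustionActQ G hconn hqt o γ' (levelExhaustionActQ G hconn hqt o γ ξ) := by
  unfold levelExhaustionActQ
  rw [autHeightQ_trans, add_comm, exhaustionShift_add]

/-- The identity automorphism acts trivially on the seeds. [folklore] -/
@[simp] theorem levelExhaustionActQ_refl (ξ : ExhaustionSeeds (heightGroupQ G hqt o)) :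
    levelExhaustionActQ G hconn hqt o (RelIso.refl _) ξ = ξ := by
  unfold levelExhaustionActQ
  rw [autHeightQ_refl, exhaustionShift_zero]

/-- The action is by measurable maps … [folklore] -/
theorem measurable_levelExhaustionActQ (γ : G ≃g G) : Measurable (levelExhaustionActQ G hconn hqt o γ) :=
  measurable_exhaustionShift _

/-- … preserving the law of the seeds. [cite: Timar2006, Prop. 5.4 ("invariant")] -/
theorem measurePreserving_levelExhaustionActQ (γ : G ≃g G) :
    MeasurePreserving (levelExhaustionActQ G hconn hqt o γ)
      (boxSeedMeasure (LevelCoordIndex (heightGroupQ G hqt o)))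
      (boxSeedMeasure (LevelCoordIndex (heightGroupQ G hqt o))) :=
  measurePreserving_exhaustionShift _

/-- `Measure.map` form. [cite: Timar2006, Prop. 5.4 ("invariant")] -/
theorem map_levelExhaustionActQ (γ : G ≃g G) :
    (boxSeedMeasure (LevelCoordIndex (heightGroupQ G hqt o))).map (levelExhaustionActQ G hconn hqt o γ) =
      boxSeedMeasure (LevelCoordIndex (heightGroupQ G hqt o)) :=
  (measurePreserving_levelExhaustionActQ G hconn hqt o γ).map_eq

/-- The events "`x ∼_m y`" are measurable in the seed. [folklore] -/
theorem measurableSet_setOf_levelExhaustionRelQ (m : ℕ) (x y : V) :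
    MeasurableSet {ξ | LevelExhaustionRelQ G hconn hqt o m ξ x y} :=
  measurableSet_setOf_exhaustionRel m _ _

/-- **The exhaustion property for the levels of `G`**. [cite: Timar2006, Prop. 5.4 ("with probability tending to 1 as i → ∞")] -/
theorem tendsto_measure_levelExhaustionRelQ (x y : V) :
    Tendsto (fun m : ℕ => boxSeedMeasure (LevelCoordIndex (heightGroupQ G hqt o))
      {ξ | LevelExhaustionRelQ G hconn hqt o m ξ x y}) atTop (𝓝 1) :=
  tendsto_measure_exhaustionRel _ _ _

/-- **"Any set of finitely many levels of `G` is contained in the same class of `P_i` with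
probability tending to 1"** (complement form). [cite: Timar2006, Thm. 5.5 (proof, last paragraph) and Prop. 5.4] -/
theorem tendsto_measure_not_forall_levelExhaustionRelQ (S : Finset V) :
    Tendsto (fun m : ℕ => boxSeedMeasure (LevelCoordIndex (heightGroupQ G hqt o))
      {ξ | ¬ ∀ x ∈ S, ∀ y ∈ S, LevelExhaustionRelQ G hconn hqt o m ξ x y}) atTop (𝓝 0) := by
  classical
  have h : ∀ m : ℕ, {ξ : ExhaustionSeeds (heightGroupQ G hqt o) |
      ¬ ∀ x ∈ S, ∀ y ∈ S, LevelExhaustionRelQ G hconn hqt o m ξ x y} =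
      {ξ | ¬ ∀ a ∈ S.image (levelEltQ G hconn hqt o), ∀ b ∈ S.image (levelEltQ G hconn hqt o),
        ExhaustionRel m ξ a b} := by
    intro m; ext ξ
    simp only [Set.mem_setOf_eq, Finset.forall_mem_image, LevelExhaustionRelQ]
  simp_rw [h]
  exact tendsto_measure_not_forall_exhaustionRel _

/-- The event "the levels of `S` are inside one class of `P_m`" is measurable. [folklore] -/
theorem measurableSet_setOf_forall_levelExhaustionRelQ (m : ℕ) (S : Finset V) :
    MeasurableSet {ξ : ExhaustionSeeds (heightGroupQ G hqt o) |
      ∀ x ∈ S, ∀ y ∈ S, LevelExhaustionRelQ G hconn hqt o m ξ x y} := by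
  have h : {ξ : ExhaustionSeeds (heightGroupQ G hqt o) |
      ∀ x ∈ S, ∀ y ∈ S, LevelExhaustionRelQ G hconn hqt o m ξ x y} =
      ⋂ x ∈ S, ⋂ y ∈ S, {ξ | LevelExhaustionRelQ G hconn hqt o m ξ x y} := by
    ext ξ; simp only [Set.mem_setOf_eq, Set.mem_iInter]
  rw [h]
  exact Finset.measurableSet_biInter S fun x _ =>
    Finset.measurableSet_biInter S fun y _ => measurableSet_setOf_levelExhaustionRelQ G hconn hqt o m x y

/-- The levels of finitely many vertices are inside one class of `P_m` with probability `→ 1`.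
[cite: Timar2006, Thm. 5.5 (proof, last paragraph) and Prop. 5.4] -/
theorem tendsto_measure_forall_levelExhaustionRelQ (S : Finset V) :
    Tendsto (fun m : ℕ => boxSeedMeasure (LevelCoordIndex (heightGroupQ G hqt o))
      {ξ | ∀ x ∈ S, ∀ y ∈ S, LevelExhaustionRelQ G hconn hqt o m ξ x y}) atTop (𝓝 1) := by
  classical
  have h : ∀ m : ℕ, {ξ : ExhaustionSeeds (heightGroupQ G hqt o) |
      ∀ x ∈ S, ∀ y ∈ S, LevelExhaustionRelQ G hconn hqt o m ξ x y} =
      {ξ | ∀ a ∈ S.image (levelEltQ G hconn hqt o), ∀ b ∈ S.image (levelEltQ G hconn hqt o),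
        ExhaustionRel m ξ a b} := by
    intro m; ext ξ
    simp only [Set.mem_setOf_eq, Finset.forall_mem_image, LevelExhaustionRelQ]
  simp_rw [h]
  exact tendsto_measure_forall_exhaustionRel _

end

/-- **Timár 2006, Prop. 5.4 on quasi-transitive graphs, PROVED.** For a connected, locally
finite, quasi-transitive graph `G` there is a probability space with an action of `Aut(G)` by
measure-preserving maps and a sequence of random relations `∼_m` on the vertices such that:
each `∼_m` is an equivalence relation depending only on the levels, whose classes are finite
unions of levels, the family is `Aut(G)`-invariant, and any two vertices are `∼_m`-related with
probability tending to `1`. [cite: Timar2006, Prop. 5.4] [cite: Hutchcroft2016, §2] -/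
theorem Timar2006_prop54_levels_quasiTransitive {V : Type*} (G : SimpleGraph V) [G.LocallyFinite]
    (hconn : G.Connected) (hqt : IsQuasiTransitive G) (o : V) :
    ∃ (Ω : Type) (_ : MeasurableSpace Ω) (P : Measure Ω) (_ : IsProbabilityMeasure P)
      (act : (G ≃g G) → Ω → Ω) (rel : ℕ → Ω → V → V → Prop),
      (∀ γ γ', act (γ.trans γ') = act γ' ∘ act γ) ∧
      (∀ γ, MeasurePreserving (act γ) P P) ∧
      (∀ m ξ, Equivalence (rel m ξ)) ∧
      (∀ m ξ x x' y, SameLevel G x x' → rel m ξ x y → rel m ξ x' y) ∧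
      (∀ m ξ x, ∃ S : Finset V, {y | rel m ξ x y} = levelUnion G S) ∧
      (∀ m ξ γ x y, rel m (act γ ξ) (γ x) (γ y) ↔ rel m ξ x y) ∧
      (∀ m x y, MeasurableSet {ξ | rel m ξ x y}) ∧
      (∀ x y, Tendsto (fun m => P {ξ | rel m ξ x y}) atTop (𝓝 1)) :=
  ⟨ExhaustionSeeds (heightGroupQ G hqt o), inferInstance, boxSeedMeasure _, inferInstance,
    levelExhaustionActQ G hconn hqt o, LevelExhaustionRelQ G hconn hqt o,
    fun γ γ' => funext (levelExhaustionActQ_trans G hconn hqt o γ γ'),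
    measurePreserving_levelExhaustionActQ G hconn hqt o,
    levelExhaustionRelQ_equivalence G hconn hqt o,
    fun _ _ _ _ _ hx h => levelExhaustionRelQ_of_sameLevel G hconn hqt o hx h,
    exists_setOf_levelExhaustionRelQ_eq_levelUnion G hconn hqt o,
    levelExhaustionRelQ_act_iff G hconn hqt o,
    measurableSet_setOf_levelExhaustionRelQ G hconn hqt o,
    tendsto_measure_levelExhaustionRelQ G hconn hqt o⟩

end HeightGroup

end Literature.Barriers.CriticalPhenomena

end
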